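import Mathlib

/-!
# Tower graft line, stub S1: the base-`X^D` digit expansion of a one-letter graft

By-name closer for the registered stub **S1 `stub_digitExpansion : TowerDigitExpansion`** of the line
`Cruxes/WeakLifting/Lines/tower_graft.lean` (rev 2, commit 93fc8a4763ba; crux `WeakLifting` =
stmt-ValiantsHypothesis-19561, restricted sub-case `TowerWeakLifting`; line planner val-idea-24 g0, critic of record
val-idea-crit-6 g0, director R266 (B), lead g27 R2667 (B) / R2672 (A)).

`tower_digitExpansion` is the line's `TowerDigitExpansion` VERBATIM (the `let`-bound pencil `G = ∑ₗ X^{dₗ} Sₗ` and the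
bivariate determinant `Q(X,T) = det (G + T·S_top) ∈ ℝ[X][T]` inlined exactly as in the line file), so the line discharges
the stub by `exact` (definitional unfolding).  Content, for `m·dₗ < D` (all `l`) and `0 < D`:

* `det (G + X^D S_top) = ∑_{j ≤ m} X^{D·j} · [T^j] Q` — evaluate the ring hom `T ↦ X^D` through the determinant
  (`RingHom.map_det`) and expand `Q.eval (X^D)` along `natDegree_T Q ≤ m` (`Polynomial.natDegree_det_X_add_C_le`);
* every digit `[T^j] Q` has `natDegree < D` — Leibniz: each `T`-coefficient of a product of `m` entries
  `C gᵢₖ + T·C(C sᵢₖ)` with `natDegree gᵢₖ ≤ N := max dₗ` has `X`-degree `≤ m·N < D`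
  (`natDegree_coeff_mul_le`, `natDegree_coeff_prod_le`: the `X`-degree of `T`-coefficients is sub-multiplicative).

So `det F` is the non-overlapping digit string of `Q` in base `X^D`, i.e. `det F = Q(X, X^D)`.  Def-free; Mathlib only.
HONEST FRAMING: an algebraic MECHANISM LEMMA (verdict #7 (P1): used by the S4/S5 proofs, not a skeleton joint) of a
skeleton for a RESTRICTED sub-case (`TowerWeakLifting`) of the crux; nothing here bears on `WeakLifting` itself, on
Conjecture B / `KPlusLogSqLaw`, on `MatrixDescartes` (18050) or on `VP ≠ VNP`.
Seat: prover val-sym-lift-p3 g16, `--supports stmt-ValiantsHypothesis-19561`.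
-/

-- `Summit.ValiantsHypothesis.ValiantsHypothesis.…` repeats a component by the D-0017 layout
-- (single-conjunct summit), which the `dupNamespace` linter flags; the name is mandated.
set_option linter.dupNamespace false

namespace Summit.ValiantsHypothesis.ValiantsHypothesis.Theorems.KPlusLogSqLaw.TowerGraft

open Finset Polynomial
open scoped BigOperators Polynomial

/-- `X`-degree bookkeeping in `ℝ[X][T]`: if every `T`-coefficient of `p` (resp. `q`) has `natDegree ≤ a` (resp. `≤ b`),
every `T`-coefficient of `p * q` has `natDegree ≤ a + b` (Cauchy product). [folklore] -/
theorem natDegree_coeff_mul_le {p q : Polynomial ℝ[X]} {a b : ℕ}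
    (hp : ∀ j, (p.coeff j).natDegree ≤ a) (hq : ∀ j, (q.coeff j).natDegree ≤ b) (j : ℕ) :
    ((p * q).coeff j).natDegree ≤ a + b := by
  rw [Polynomial.coeff_mul]
  refine Polynomial.natDegree_sum_le_of_forall_le _ _ fun x _ => ?_
  exact Polynomial.natDegree_mul_le.trans (add_le_add (hp _) (hq _))

/-- `X`-degree bookkeeping in `ℝ[X][T]`: finite products — a uniform bound `a` on the `X`-degrees of the
`T`-coefficients of each factor gives the bound `#s · a` for the product. [folklore] -/
theorem natDegree_coeff_prod_le {ι : Type*} [DecidableEq ι] (s : Finset ι) (f : ι → Polynomial ℝ[X]) {a : ℕ}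
    (hf : ∀ i ∈ s, ∀ j, ((f i).coeff j).natDegree ≤ a) (j : ℕ) :
    ((∏ i ∈ s, f i).coeff j).natDegree ≤ s.card * a := by
  induction s using Finset.induction_on generalizing j with
  | empty =>
    simp only [Finset.prod_empty, Finset.card_empty, zero_mul, Polynomial.coeff_one]
    split_ifs <;> simp
  | insert i s hi ih =>
    rw [Finset.prod_insert hi, Finset.card_insert_of_notMem hi]
    have h1 : ∀ j, ((f i).coeff j).natDegree ≤ a := hf i (Finset.mem_insert_self i s)
    have h2 : ∀ j, ((∏ x ∈ s, f x).coeff j).natDegree ≤ s.card * a :=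
      fun j => ih (fun x hx => hf x (Finset.mem_insert_of_mem hx)) j
    calc ((f i * ∏ x ∈ s, f x).coeff j).natDegree ≤ a + s.card * a := natDegree_coeff_mul_le h1 h2 j
      _ = (s.card + 1) * a := by ring

/-- the entries of the bivariate graft matrix: every `T`-coefficient of `C g + T · C (C c)` has `natDegree ≤ natDegree g`.
[folklore] -/
theorem natDegree_coeff_C_add_X_mul_C_le (g : ℝ[X]) (c : ℝ) (j : ℕ) :
    ((C g + (X : Polynomial ℝ[X]) * C (C c)).coeff j).natDegree ≤ g.natDegree := by
  rw [Polynomial.X_mul, coeff_add, coeff_C, coeff_C_mul_X]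
  split_ifs <;> simp

/-- **S1 `stub_digitExpansion` (the line's `TowerDigitExpansion`, verbatim).**  Grafting a far letter `X^D • S_top`
(`m · dₗ < D` for all `l`, `0 < D`) on the pencil `G = ∑ₗ X^{dₗ} • Sₗ` of real `m × m` matrices:
`det (G + X^D S_top) = ∑_{j ≤ m} X^{D j} · [T^j] det (G + T · S_top)`, and every digit `[T^j] det (G + T · S_top)` has
`natDegree < D` (or vanishes) — the determinant is the base-`X^D` digit string of `Q(X,T) = det (G + T S_top)`, i.e.
`det F = Q(X, X^D)` with non-overlapping digits. [this work] -/
theorem tower_digitExpansion :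
    ∀ (m K D : ℕ) (d : Fin K → ℕ) (S : Fin K → Matrix (Fin m) (Fin m) ℝ) (Stop : Matrix (Fin m) (Fin m) ℝ),
    (∀ l, m * d l < D) → 0 < D →
    let G : Matrix (Fin m) (Fin m) ℝ[X] := ∑ l, (X : ℝ[X]) ^ d l • (S l).map Polynomial.C
    let Q : Polynomial ℝ[X] := (G.map (C : ℝ[X] →+* Polynomial ℝ[X]) +
      (X : Polynomial ℝ[X]) • Stop.map ((C : ℝ[X] →+* Polynomial ℝ[X]).comp (C : ℝ →+* ℝ[X]))).det
    (G + (X : ℝ[X]) ^ D • Stop.map Polynomial.C).det = ∑ j ∈ Finset.range (m + 1), (X : ℝ[X]) ^ (D * j) * Q.coeff j ∧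
      ∀ j, (Q.coeff j).natDegree < D ∨ Q.coeff j = 0 := by
  intro m K D d S Stop hdD hD G Q
  -- the bivariate graft matrix `M = G + T · S_top` over `ℝ[X][T]`; `Q = det M`
  set M : Matrix (Fin m) (Fin m) (Polynomial ℝ[X]) := G.map (C : ℝ[X] →+* Polynomial ℝ[X]) +
      (X : Polynomial ℝ[X]) • Stop.map ((C : ℝ[X] →+* Polynomial ℝ[X]).comp (C : ℝ →+* ℝ[X])) with hM
  have hQ : Q = M.det := rfl
  -- a uniform exponent bound `N` with `m · N < D`
  obtain ⟨N, hdN, hN⟩ : ∃ N : ℕ, (∀ l, d l ≤ N) ∧ m * N < D := by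
    rcases isEmpty_or_nonempty (Fin K) with hK | hK
    · exact ⟨0, fun l => isEmptyElim l, by simpa using hD⟩
    · obtain ⟨l₀, -, hl₀⟩ := Finset.exists_mem_eq_sup (Finset.univ : Finset (Fin K)) Finset.univ_nonempty d
      exact ⟨Finset.univ.sup d, fun l => Finset.le_sup (Finset.mem_univ l), by rw [hl₀]; exact hdD l₀⟩
  -- entries of `G` have `natDegree ≤ N`
  have hG : ∀ i k, (G i k).natDegree ≤ N := by
    intro i k
    have hGik : G i k = ∑ l, (X : ℝ[X]) ^ d l * C ((S l) i k) := by
      simp only [G, Matrix.sum_apply, Matrix.smul_apply, Matrix.map_apply, smul_eq_mul]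
    rw [hGik]
    refine Polynomial.natDegree_sum_le_of_forall_le _ _ fun l _ => ?_
    refine Polynomial.natDegree_mul_le.trans ?_
    rw [Polynomial.natDegree_C, add_zero]
    exact (Polynomial.natDegree_X_pow_le _).trans (hdN l)
  -- entries of `M`: every `T`-coefficient has `X`-degree `≤ N`
  have hMe : ∀ i k, ∀ j, ((M i k).coeff j).natDegree ≤ N := by
    intro i k j
    have hMik : M i k = C (G i k) + (X : Polynomial ℝ[X]) * C (C (Stop i k)) := by
      simp only [hM, Matrix.add_apply, Matrix.map_apply, Matrix.smul_apply, smul_eq_mul, RingHom.coe_comp,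
        Function.comp_apply]
    rw [hMik]
    exact (natDegree_coeff_C_add_X_mul_C_le _ _ j).trans (hG i k)
  -- hence every digit `[T^j] Q` has `X`-degree `≤ m · N < D` (Leibniz expansion)
  have hdigit : ∀ j, (Q.coeff j).natDegree ≤ m * N := by
    intro j
    rw [hQ, Matrix.det_apply', Polynomial.finsetSum_coeff]
    refine Polynomial.natDegree_sum_le_of_forall_le _ _ fun σ _ => ?_
    have hprod : ∀ j, ((∏ i, M (σ i) i).coeff j).natDegree ≤ m * N := by
      intro j
      have h := natDegree_coeff_prod_le (Finset.univ : Finset (Fin m)) (fun i => M (σ i) i)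
        (fun i _ => hMe (σ i) i) j
      simpa only [Finset.card_univ, Fintype.card_fin] using h
    -- the sign `ε σ = C (C ±1)` has `X`-degree `0` in every `T`-coefficient
    have hsign : ∀ j, ((((Equiv.Perm.sign σ : ℤ) : Polynomial ℝ[X])).coeff j).natDegree ≤ 0 := by
      intro j
      rw [← Polynomial.C_eq_intCast, ← Polynomial.C_eq_intCast, Polynomial.coeff_C]
      split_ifs <;> simp
    simpa only [zero_add] using natDegree_coeff_mul_le hsign hprod j
  refine ⟨?_, fun j => Or.inl ((hdigit j).trans_lt hN)⟩
  -- the digit string: evaluate `T ↦ X^D` through the determinant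
  have hTdeg : Q.natDegree ≤ m := by
    have hM' : M = (X : Polynomial ℝ[X]) • (Stop.map (C : ℝ →+* ℝ[X])).map (C : ℝ[X] →+* Polynomial ℝ[X]) +
        G.map (C : ℝ[X] →+* Polynomial ℝ[X]) := by
      rw [hM, add_comm, Matrix.map_map, RingHom.coe_comp]
    rw [hQ, hM']
    simpa only [Fintype.card_fin] using Polynomial.natDegree_det_X_add_C_le (Stop.map (C : ℝ →+* ℝ[X])) G
  have heval : (G + (X : ℝ[X]) ^ D • Stop.map Polynomial.C).det = Q.eval ((X : ℝ[X]) ^ D) := by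
    change _ = Polynomial.evalRingHom ((X : ℝ[X]) ^ D) Q
    rw [hQ, RingHom.map_det, RingHom.mapMatrix_apply]
    congr 1
    ext i k
    simp [hM, Matrix.add_apply, Matrix.map_apply, Matrix.smul_apply]
  rw [heval, Polynomial.eval_eq_sum_range' (Nat.lt_succ_of_le hTdeg)]
  exact Finset.sum_congr rfl fun j _ => by rw [← pow_mul, mul_comm]

end Summit.ValiantsHypothesis.ValiantsHypothesis.Theorems.KPlusLogSqLaw.TowerGraft
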